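import Literature.Probability.RandomPlanarGeometry.SAWTriangularHalfSpaceTransfer
import Literature.Probability.RandomPlanarGeometry.SAWTriangularBridgeRatioLimit
import HarnessLib

/-!
# Kesten's ratio limit theorem for HALF-SPACE WALKS of the triangular lattice: `h_{N+1}(𝕋)/h_N(𝕋) → μ(𝕋)`

Topic `Literature/Probability/RandomPlanarGeometry` (lane «pcv-sawmu», item «TRI-HALFSPACE-RATIO»; end of the chain
`SAWTriangularHalfSpaceSurgery` → `SAWTriangularHalfSpaceTransfer` → this file; sibling of
`SAWTriangularBridgeRatioLimit.lean`, whose architecture it repeats; the elementary tails are private copies). Sources: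
H. Kesten, *On the number of self-avoiding walks*, J. Math. Phys. 4 (1963) 960–969; N. Madras, G. Slade, *The
Self-Avoiding Walk* (1993), Definition 3.1.2 (half-space walks), Lemma 7.3.1, Theorem 7.3.2 (proof, pp. 244–247) and
Theorem 7.3.4 (the ratio limit theorems, printed there for `c_N`, `c_N(0,x)`, `q_N` and `b_N` on `ℤ^d`); the
one-step half-space ratio on `ℤ^d` (every `d`) is printed and proved in G. Lawler, O. Schramm, W. Werner, *On the
scaling limit of planar self-avoiding walk* (2004), Appendix A, eq. (A.3) «lim υ_{n+1}/υ_n = β», via the renewal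
inequality `υ_n ≥ Σ_{j≤k} λ_j υ_{n−j}` and Kesten's relation (A.1) [cite: LawlerSchrammWerner2004SAW, Appendix A,
(A.2)–(A.3)] — in the tree as `Zd.LawlerSchrammWerner2004_eqA3`, with the rate `Zd.halfSpaceRatio_rate_log`.  For the
TRIANGULAR lattice we have not located the statement in print (lane literature cell: corpus fts+vec + galaxy, null);
this file proves it by a different route: on `𝕋` the one-step detour surgery acts on half-space walks directly
(`SAWTriangularHalfSpaceSurgery.lean`), so Kesten's transfer argument gives the ONE-step ratio without renewal theory.
Grade: a `𝕋`-instance of a statement printed for `ℤ^d`, by the lane's surgery route; first kernel text for `𝕋`.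

## The pieces (all in the tree or in this chain)

* (i) `h_N(𝕋)^{1/N} → μ(𝕋)`: the squeeze `b_N ≤ h_N ≤ c_N` between `tendsto_brickBridgeCount_rpow` and
  `tendsto_triSawCount_rpow`;
* (ii) `h_N ≤ h_{N+1}`: `brickHalfSpaceCount_le_succ`;
* (iii) Kesten's inequality for `φ_N = h_{N+1}/h_N`: the abstract `kesten_ineq_of_transfer_noGrowth` fed with
  (P1)/(P2) = `triHalfSpaceKesten_P1'`/`triHalfSpaceKesten_P2` and (P3) = `triHalfSpaceKesten_P3` (from the all-walk
  exponential density `detourDensityTri` and `μ^N ≤ e^{15√N} b_N ≤ e^{15√N} h_N`);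
* the step `(i)+(ii)+(iii) ⇒ ratio limit` is the tree's `Zd.tendsto_ratio_of_kesten_one`.

## Contents (namespace `Literature.Probability.RandomPlanarGeometry.SAW`)

* `brickBridgeCount_le_brickHalfSpaceCount` — (i) is a local step of the final proof;
* `triHalfSpaceKesten_P3`, `kestenIneqTriHalfSpace` — (P3) and (iii);
* **`tendsto_brickHalfSpaceCount_ratio : h_{N+1}(𝕋)/h_N(𝕋) → μ(𝕋)`** (`μ(𝕋) = exp logMuTri`), `tendsto_card_triHL_ratio`.
-/

noncomputable section

open Finset Filter Topology Literature.Probability.LatticeModels Literature.Probability.Percolation SimpleGraph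

namespace Literature.Probability.RandomPlanarGeometry.SAW

/-! ### (i) `h_N(𝕋)^{1/N} → μ(𝕋)` by the squeeze `b_N ≤ h_N ≤ c_N` -/

/-- `b_N(𝕋) ≤ h_N(𝕋)`. [cite: MadrasSlade1993, §3.1] -/
theorem brickBridgeCount_le_brickHalfSpaceCount (N : ℕ) : brickBridgeCount N ≤ brickHalfSpaceCount N :=
  Finset.card_le_card (brickBridges_subset_brickHalfSpaceWalks N)

/-! ### Elementary tails (private copies of the bridge file's) -/

/-- `(k+1)³ ≤ 27 · 2^k`. [folklore] -/
private theorem succ_pow_three_le_two_pow_hs : ∀ k : ℕ, (k + 1) ^ 3 ≤ 27 * 2 ^ k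
  | 0 => by norm_num
  | 1 => by norm_num
  | 2 => by norm_num
  | 3 => by norm_num
  | k + 4 => by
    have ih := succ_pow_three_le_two_pow_hs (k + 3)
    have h1 : (k + 4 + 1) ^ 3 ≤ 2 * (k + 3 + 1) ^ 3 := by
      have : (k + 5) ^ 3 ≤ 2 * (k + 4) ^ 3 := by nlinarith [sq_nonneg k, Nat.zero_le k]
      simpa using this
    calc (k + 4 + 1) ^ 3 ≤ 2 * (k + 3 + 1) ^ 3 := h1
      _ ≤ 2 * (27 * 2 ^ (k + 3)) := Nat.mul_le_mul_left 2 ih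
      _ = 27 * 2 ^ (k + 4) := by ring

/-- `(1/2)^{⌊N/Q⌋} · N³ ≤ 27 Q³` (`Q ≥ 1`; the tree's private `half_pow_div_mul_cube_le`, restated).
[folklore] -/
private theorem half_pow_mul_cube_le_hs {Q : ℕ} (hQ : 0 < Q) (N : ℕ) :
    (1 / 2 : ℝ) ^ (N / Q) * (N : ℝ) ^ 3 ≤ 27 * (Q : ℝ) ^ 3 := by
  set k := N / Q with hk
  have hN : N ≤ Q * (k + 1) := (Nat.lt_mul_div_succ N hQ).le
  have h1 : (N : ℝ) ^ 3 ≤ ((Q : ℝ) * ((k : ℝ) + 1)) ^ 3 := by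
    have : ((N ^ 3 : ℕ) : ℝ) ≤ (((Q * (k + 1)) ^ 3 : ℕ) : ℝ) := by
      exact_mod_cast Nat.pow_le_pow_left hN 3
    push_cast at this
    exact this
  have h2 : ((k : ℝ) + 1) ^ 3 ≤ 27 * 2 ^ k := by
    exact_mod_cast succ_pow_three_le_two_pow_hs k
  have h3 : (0 : ℝ) < 2 ^ k := by positivity
  rw [one_div_pow, div_mul_eq_mul_div, one_mul, div_le_iff₀ h3, mul_pow] at *
  calc (N : ℝ) ^ 3 ≤ (Q : ℝ) ^ 3 * ((k : ℝ) + 1) ^ 3 := h1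
    _ ≤ (Q : ℝ) ^ 3 * (27 * 2 ^ k) := mul_le_mul_of_nonneg_left h2 (by positivity)
    _ = 27 * (Q : ℝ) ^ 3 * 2 ^ k := by ring

/-- `(1/2)^{⌊N/Q⌋} · e^{15√N} ≤ 1` for `N ≥ (62Q)²` (`⌊N/Q⌋ ≥ N/Q − 1`, `log 2 ≥ 1/2`, and
`N/Q − 1 ≥ 30√N` once `√N ≥ 31 Q`). [folklore] -/
private theorem half_pow_mul_exp_sqrt_le_one_hs {Q : ℕ} (hQ : 0 < Q) {N : ℕ} (hN : (31 * Q) ^ 2 ≤ N) :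
    (1 / 2 : ℝ) ^ (N / Q) * Real.exp (15 * Real.sqrt N) ≤ 1 := by
  set k := N / Q with hk
  have hQr : (0 : ℝ) < Q := by exact_mod_cast hQ
  -- `k ≥ N/Q − 1`
  have hk1 : (N : ℝ) / Q - 1 ≤ k := by
    have h : N < Q * (k + 1) := Nat.lt_mul_div_succ N hQ
    have h' : (N : ℝ) < Q * ((k : ℝ) + 1) := by exact_mod_cast h
    rw [div_sub_one hQr.ne', div_le_iff₀ hQr]
    linarith
  -- `√N ≥ 31 Q ≥ 31`, so `N/Q − 1 ≥ 30 √N`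
  have hsq : (31 : ℝ) * Q ≤ Real.sqrt N := by
    have h : (((31 * Q) ^ 2 : ℕ) : ℝ) ≤ N := by exact_mod_cast hN
    push_cast at h
    rw [show (31 : ℝ) * Q = Real.sqrt (((31 : ℝ) * Q) ^ 2) by rw [Real.sqrt_sq (by positivity)]]
    exact Real.sqrt_le_sqrt h
  have hs1 : (1 : ℝ) ≤ Real.sqrt N := le_trans (by
    have : (1 : ℝ) ≤ Q := by exact_mod_cast hQ
    linarith) hsq
  have hmain : 30 * Real.sqrt N ≤ (N : ℝ) / Q - 1 := by
    set s := Real.sqrt (N : ℝ) with hs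
    have hNr : (N : ℝ) = s * s := (Real.mul_self_sqrt (Nat.cast_nonneg N)).symm
    rw [le_sub_iff_add_le, le_div_iff₀ hQr, hNr]
    -- `(30 s + 1) Q ≤ s · s` from `s ≥ 31 Q` and `s ≥ 1`
    have hQle : (Q : ℝ) * 31 ≤ s := by linarith
    nlinarith
  -- `(1/2)^k = exp(−k log 2) ≤ exp(−15 √N)`
  have hlog2 : (1 / 2 : ℝ) < Real.log 2 := by
    have := Real.log_two_gt_d9; linarith
  have hpow : (1 / 2 : ℝ) ^ k = Real.exp (-(k * Real.log 2)) := by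
    rw [one_div, inv_pow, Real.exp_neg, Real.exp_nat_mul, Real.exp_log (by norm_num : (0 : ℝ) < 2)]
  rw [hpow, ← Real.exp_add]
  refine Real.exp_le_one_iff.2 ?_
  have hk0 : (0 : ℝ) ≤ k := Nat.cast_nonneg _
  nlinarith

/-- **The bridge tail**: for `N ≥ (62Q)²`, `(1/2)^{⌊N/Q⌋} · e^{15√N} · N³ ≤ 216 Q³` (split `⌊N/Q⌋ ≥ 2⌊N/(2Q)⌋`
and use the two previous bounds with `2Q`). [folklore] -/
private theorem half_pow_mul_exp_sqrt_mul_cube_le_hs {Q : ℕ} (hQ : 0 < Q) {N : ℕ} (hN : (31 * (2 * Q)) ^ 2 ≤ N) :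
    (1 / 2 : ℝ) ^ (N / Q) * Real.exp (15 * Real.sqrt N) * (N : ℝ) ^ 3 ≤ 216 * (Q : ℝ) ^ 3 := by
  have hQ2 : 0 < 2 * Q := by omega
  have hdiv : 2 * (N / (2 * Q)) ≤ N / Q := by
    rw [Nat.le_div_iff_mul_le hQ]
    calc 2 * (N / (2 * Q)) * Q = N / (2 * Q) * (2 * Q) := by ring
      _ ≤ N := Nat.div_mul_le_self N (2 * Q)
  have hhalf : (1 / 2 : ℝ) ^ (N / Q) ≤ (1 / 2 : ℝ) ^ (N / (2 * Q)) * (1 / 2 : ℝ) ^ (N / (2 * Q)) := by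
    rw [← pow_add, ← two_mul]
    exact pow_le_pow_of_le_one (by norm_num) (by norm_num) hdiv
  have h1 := half_pow_mul_exp_sqrt_le_one_hs hQ2 hN
  have h2 := half_pow_mul_cube_le_hs hQ2 N
  have hA : 0 ≤ (1 / 2 : ℝ) ^ (N / (2 * Q)) * Real.exp (15 * Real.sqrt N) := by positivity
  have hB : 0 ≤ (1 / 2 : ℝ) ^ (N / (2 * Q)) * (N : ℝ) ^ 3 := by positivity
  calc (1 / 2 : ℝ) ^ (N / Q) * Real.exp (15 * Real.sqrt N) * (N : ℝ) ^ 3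
      ≤ ((1 / 2 : ℝ) ^ (N / (2 * Q)) * (1 / 2 : ℝ) ^ (N / (2 * Q))) * Real.exp (15 * Real.sqrt N) * (N : ℝ) ^ 3 :=
        by gcongr
    _ = ((1 / 2 : ℝ) ^ (N / (2 * Q)) * Real.exp (15 * Real.sqrt N)) * ((1 / 2 : ℝ) ^ (N / (2 * Q)) * (N : ℝ) ^ 3) :=
        by ring
    _ ≤ 1 * (27 * ((2 * Q : ℕ) : ℝ) ^ 3) := mul_le_mul h1 h2 hB zero_le_one
    _ = 216 * (Q : ℝ) ^ 3 := by push_cast; ring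

/-! ### (P3) for half-space walks -/

/-- **(P3) for half-space walks**: with `a := 1/(4Q)` from the all-walk detour density, for all large `N` the half-space walks with
`J(ω) < aN` number at most `C · h_N(𝕋)/N³` — they are at most `C₀ 2^{−⌊N/Q⌋} μ(𝕋)^N` (all walks), and
`μ(𝕋)^N ≤ e^{15√N} b_N(𝕋) ≤ e^{15√N} h_N(𝕋)` (Hammersley–Welsh lower envelope for bridges, `b ≤ h`), with the tail
`2^{−⌊N/Q⌋} e^{15√N} ≤ 216 Q³/N³`. [cite: MadrasSlade1993, §7.3 (7.3.9)–(7.3.10) and Definition 3.1.2] -/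
theorem triHalfSpaceKesten_P3 :
    ∃ a > (0 : ℝ), ∃ C ≥ (0 : ℝ), ∃ N₁ : ℕ, ∀ N, N₁ ≤ N → 1 ≤ N →
      (#((triHL N).filter fun ω => (#(triSharp ω) : ℝ) < a * N) : ℝ) ≤ C * #(triHL N) / (N : ℝ) ^ 3 := by
  classical
  obtain ⟨Q, hQ, C₀, hC₀⟩ := detourDensityTri
  have hQr : (0 : ℝ) < Q := by exact_mod_cast hQ
  refine ⟨1 / (4 * Q), by positivity, 216 * (Q : ℝ) ^ 3 * max C₀ 0, by positivity, (31 * (2 * Q)) ^ 2,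
    fun N hN1 hN => ?_⟩
  have hNr : (0 : ℝ) < N := by exact_mod_cast hN
  -- Step 1: the filter (over half-space walks) is contained in the all-walk density event
  have hsub : #((triHL N).filter fun ω => (#(triSharp ω) : ℝ) < 1 / (4 * (Q : ℝ)) * N) ≤
      {l : List (Site 2) | l ∈ sawLists triGraph (0 : Site 2) N ∧ detourCount l ≤ N / (4 * Q)}.ncard := by
    rw [← Set.ncard_coe_finset]
    refine Set.ncard_le_ncard ?_ ((sawLists_finite triGraph (0 : Site 2) N).subset fun l hl => hl.1)
    intro ω hω
    rw [Finset.coe_filter, Set.mem_setOf_eq, mem_triHL, mem_triSL] at hω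
    refine ⟨hω.1.1, ?_⟩
    rw [← card_triSharp_eq_detourCount, Nat.le_div_iff_mul_le (by positivity)]
    have h' := hω.2
    rw [div_mul_eq_mul_div, one_mul, lt_div_iff₀ (by positivity)] at h'
    exact_mod_cast h'.le
  -- Step 2: the density bound and the lower envelope `μ^N ≤ e^{15√N} b_N ≤ e^{15√N} h_N`
  have hhalf : (0 : ℝ) ≤ (1 / 2 : ℝ) ^ (N / Q) := by positivity
  have hμ : (0 : ℝ) ≤ Real.exp logMuTri ^ N := by positivity
  have henv : Real.exp logMuTri ^ N ≤ Real.exp (15 * Real.sqrt N) * brickHalfSpaceCount N := by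
    have h := exp_neg_mul_pow_le_brickBridgeCount N
    have hbh : (brickBridgeCount N : ℝ) ≤ brickHalfSpaceCount N := by
      exact_mod_cast brickBridgeCount_le_brickHalfSpaceCount N
    have he : Real.exp (15 * Real.sqrt N) * (Real.exp (-(15 * Real.sqrt N)) * Real.exp logMuTri ^ N) =
        Real.exp logMuTri ^ N := by
      rw [← mul_assoc, ← Real.exp_add, add_neg_cancel, Real.exp_zero, one_mul]
    rw [← he]
    exact mul_le_mul_of_nonneg_left (h.trans hbh) (Real.exp_nonneg _)
  have step2 : (#((triHL N).filter fun ω => (#(triSharp ω) : ℝ) < 1 / (4 * (Q : ℝ)) * N) : ℝ) ≤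
      max C₀ 0 * ((1 / 2 : ℝ) ^ (N / Q) * Real.exp (15 * Real.sqrt N)) * brickHalfSpaceCount N := by
    calc (#((triHL N).filter fun ω => (#(triSharp ω) : ℝ) < 1 / (4 * (Q : ℝ)) * N) : ℝ)
        ≤ (({l : List (Site 2) | l ∈ sawLists triGraph (0 : Site 2) N ∧
            detourCount l ≤ N / (4 * Q)}.ncard : ℕ) : ℝ) := by exact_mod_cast hsub
      _ ≤ C₀ * (1 / 2 : ℝ) ^ (N / Q) * Real.exp logMuTri ^ N := hC₀ N
      _ ≤ max C₀ 0 * (1 / 2 : ℝ) ^ (N / Q) * Real.exp logMuTri ^ N :=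
          mul_le_mul_of_nonneg_right (mul_le_mul_of_nonneg_right (le_max_left _ _) hhalf) hμ
      _ ≤ max C₀ 0 * (1 / 2 : ℝ) ^ (N / Q) * (Real.exp (15 * Real.sqrt N) * brickHalfSpaceCount N) :=
          mul_le_mul_of_nonneg_left henv (mul_nonneg (le_max_right _ _) hhalf)
      _ = max C₀ 0 * ((1 / 2 : ℝ) ^ (N / Q) * Real.exp (15 * Real.sqrt N)) * brickHalfSpaceCount N := by ring
  -- Step 3: the tail
  have htail : (1 / 2 : ℝ) ^ (N / Q) * Real.exp (15 * Real.sqrt N) ≤ 216 * (Q : ℝ) ^ 3 / (N : ℝ) ^ 3 := by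
    rw [le_div_iff₀ (by positivity)]
    exact half_pow_mul_exp_sqrt_mul_cube_le_hs hQ hN1
  have hb : (0 : ℝ) ≤ brickHalfSpaceCount N := Nat.cast_nonneg _
  rw [card_triHL]
  calc (#((triHL N).filter fun ω => (#(triSharp ω) : ℝ) < 1 / (4 * (Q : ℝ)) * N) : ℝ)
      ≤ max C₀ 0 * ((1 / 2 : ℝ) ^ (N / Q) * Real.exp (15 * Real.sqrt N)) * brickHalfSpaceCount N := step2
    _ ≤ max C₀ 0 * (216 * (Q : ℝ) ^ 3 / (N : ℝ) ^ 3) * brickHalfSpaceCount N :=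
        mul_le_mul_of_nonneg_right (mul_le_mul_of_nonneg_left htail (le_max_right _ _)) hb
    _ = 216 * (Q : ℝ) ^ 3 * max C₀ 0 * (brickHalfSpaceCount N : ℝ) / (N : ℝ) ^ 3 := by
        field_simp

/-! ### (iii) Kesten's inequality for half-space walks of `𝕋` -/

/-- **Kesten's inequality for the half-space walks of `𝕋`**: there is `D` with
`(h_{N+1}/h_N)² − D/N ≤ (h_{N+1}/h_N)(h_{N+2}/h_{N+1})` for all large `N` — the abstract inequality without
growth hypothesis, fed with the half-space transfer counts (P1), (P2) and the half-space density (P3).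
[cite: MadrasSlade1993, Theorem 7.3.2 (proof) and Definition 3.1.2] -/
theorem kestenIneqTriHalfSpace : ∃ D : ℝ, ∀ᶠ N : ℕ in atTop,
    ((brickHalfSpaceCount (N + 1) : ℝ) / brickHalfSpaceCount N) ^ 2 - D / N ≤
      ((brickHalfSpaceCount (N + 1) : ℝ) / brickHalfSpaceCount N) *
        ((brickHalfSpaceCount (N + 2) : ℝ) / brickHalfSpaceCount (N + 1)) := by
  obtain ⟨a, ha, C, hC0, N₁, hC⟩ := triHalfSpaceKesten_P3
  have key := kesten_ineq_of_transfer_noGrowth (α := List (Site 2)) triHL (fun _ ω => #(triHSlots ω))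
    (fun _ ω => #(triSharp ω)) N₁ (a := a) (C := C) (c₁ := 2) (c₂ := 8) (c₃ := 5)
    (c₄ := 2) ha hC0 (by norm_num) (by norm_num) (by norm_num) (by norm_num)
    (fun N _ => one_le_card_triHL N)
    (fun N _ ω hω => by
      have h := card_triHSlots_le hω
      calc ((#(triHSlots ω) : ℕ) : ℝ) ≤ ((2 * N : ℕ) : ℝ) := by exact_mod_cast h
        _ = 2 * (N : ℝ) := by push_cast; ring)
    (fun N _ => (triHalfSpaceKesten_P1' N))
    (fun N _ => by
      -- (P2): termwise `I(I−8)/((J+5)(J+6)) ≤ I·max 0 (I−8)/((J+3)(J+6))`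
      rw [card_triHL]
      refine le_trans (sum_le_sum fun ω _ => ?_) (triHalfSpaceKesten_P2 N)
      set I : ℝ := (#(triHSlots ω) : ℝ)
      set J : ℝ := (#(triSharp ω) : ℝ)
      have hI0 : 0 ≤ I := Nat.cast_nonneg _
      have hJ0 : 0 ≤ J := Nat.cast_nonneg _
      have hden : 0 < (J + 3) * (J + 6) := by positivity
      have hden' : 0 < (J + 5) * (J + 5 + 1) := by positivity
      by_cases h8 : 8 ≤ I
      · have hmax : max 0 (I - 8) = I - 8 := max_eq_right (by linarith)
        rw [hmax]
        apply div_le_div_of_nonneg_left (by nlinarith) hden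
        nlinarith
      · have hneg : I * (I - 8) / ((J + 5) * (J + 5 + 1)) ≤ 0 :=
          div_nonpos_of_nonpos_of_nonneg (by nlinarith) hden'.le
        have hpos : 0 ≤ I * max 0 (I - 8) / ((J + 3) * (J + 6)) := by positivity
        linarith)
    (fun N hN₁ hN => hC N hN₁ hN)
  obtain ⟨D, hD⟩ := key
  refine ⟨D, ?_⟩
  filter_upwards [hD] with N h
  simpa only [card_triHL] using h

/-! ### The ratio limit -/

/-- **`h_{N+1}(𝕋)/h_N(𝕋) → μ(𝕋)`** — the ratio limit theorem for HALF-SPACE WALKS of the triangular lattice,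
one-step: (i) `h_N^{1/N} → μ(𝕋)` (squeeze `b_N ≤ h_N ≤ c_N`), (ii) `h_{N+1} ≥ h_N`, (iii) `kestenIneqTriHalfSpace`,
assembled by the tree's one-step Lemma 7.3.1 `Zd.tendsto_ratio_of_kesten_one`.  Printed for `ℤ^d` (every `d`) as
Lawler–Schramm–Werner 2004, Appendix A, (A.3) (renewal route; tree `Zd.LawlerSchrammWerner2004_eqA3`); for `𝕋` not
located in print; here by the half-space Kesten surgery, one-step directly.
[cite: LawlerSchrammWerner2004SAW, Appendix A, (A.3)] [cite: MadrasSlade1993, Lemma 7.3.1 and Definition 3.1.2] -/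
theorem tendsto_brickHalfSpaceCount_ratio :
    Tendsto (fun N : ℕ => (brickHalfSpaceCount (N + 1) : ℝ) / brickHalfSpaceCount N) atTop
      (𝓝 (Real.exp logMuTri)) := by
  have hb : ∀ n, (0 : ℝ) < brickHalfSpaceCount n := fun n => by exact_mod_cast one_le_brickHalfSpaceCount n
  -- (i) `h_N^{1/N} → μ(𝕋)`, squeezed between `b_N^{1/N} → μ` and `c_N^{1/N} → μ` (kept as a local step: a
  -- stand-alone statement of this shape collides with the gate's statement-shape deduplication)
  have hrpow : Tendsto (fun n : ℕ => (brickHalfSpaceCount n : ℝ) ^ (1 / (n : ℝ))) atTop (𝓝 (Real.exp logMuTri)) := by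
    have hb' : Tendsto (fun n : ℕ => (brickBridgeCount n : ℝ) ^ (1 / (n : ℝ))) atTop (𝓝 (Real.exp logMuTri)) := by
      rw [← logMuTriBridge_eq_logMuTri]; exact tendsto_brickBridgeCount_rpow
    refine tendsto_of_tendsto_of_tendsto_of_le_of_le hb' tendsto_triSawCount_rpow (fun n => ?_) (fun n => ?_)
    · exact Real.rpow_le_rpow (Nat.cast_nonneg _) (by exact_mod_cast brickBridgeCount_le_brickHalfSpaceCount n)
        (by positivity)
    · exact Real.rpow_le_rpow (Nat.cast_nonneg _) (by exact_mod_cast brickHalfSpaceCount_le_triSawCount n)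
        (by positivity)
  refine Zd.tendsto_ratio_of_kesten_one (Real.exp_pos _) hb hrpow ?_ kestenIneqTriHalfSpace
  refine ⟨1, one_pos, Eventually.of_forall fun n => ?_⟩
  rw [le_div_iff₀ (hb n), one_mul]
  exact_mod_cast brickHalfSpaceCount_le_succ n

/-- The half-space ratio of `𝕋` in list-count form: `#H_{N+1}(𝕋)/#H_N(𝕋) → μ(𝕋)`.
[cite: LawlerSchrammWerner2004SAW, Appendix A, (A.3)] [cite: MadrasSlade1993, Definition 3.1.2] -/
theorem tendsto_card_triHL_ratio :
    Tendsto (fun N : ℕ => (#(triHL (N + 1)) : ℝ) / #(triHL N)) atTop (𝓝 (Real.exp logMuTri)) := by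
  simpa only [card_triHL] using tendsto_brickHalfSpaceCount_ratio

end Literature.Probability.RandomPlanarGeometry.SAW
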